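import Mathlib
import Summits.CriticalPhenomena.CardyFormulaZ2.Theorems.CardySelfRefinementGradientComparabilityStubLayerFreeCellSurgery
import Summits.CriticalPhenomena.CardyFormulaZ2.Theorems.CardySelfRefinementGradientComparabilityStubNonAxialShareBulkLocal
import Literature.Probability.RandomPlanarGeometry.PlaneNonIntersectionProofs
import HarnessLib

/-!
# Boundary-layer surgery, brick (S2): transfer of pivotality at a free cell

Helper file of the registered stub `stub_layerLocalModification` (deterministic boundary-layer
surgery) of the line `monotone-product-coordinates` (crux `stmt-CriticalPhenomena-10269`,
`…Theses.CardySelfRefinement.GradientComparability`), case (S2) of the landed dichotomy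
`quadCarrier_cell_or_bridge` — **`layer_transfer_of_freeCell`** (registered helper).  Let
`e = edgeOf (v, d)` be an AXIAL edge (`ax k`, `k ≥ 2`), pivotal in `ω` for the localised joint
crossing event `Aloc m F η` of the quad family `F` (vocabulary of `CardySelfRefinementDefs`;
closure semantics, `mem_configOf_iff_exists_isCrossing_openEdgeUnion`, mesh `η√2`), and let
`C = {v, v + e_d, v + t e_{1-d}, v + e_d + t e_{1-d}}` (`t = ±1`) be the corners of a closed
lattice cell beside `e`, in FREE position for the family: every lattice edge at a corner is drawn
off `∂₀F i ∪ ∂₂F i` for every `i`; for every `i` the four cell edges are drawn inside `[F i]` or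
all off `[F i]`; and at most one quad contains them.  Then the rail `e' = edgeOf (v + t e_{1-d}, d)`
(parallel to `e`, one row off its coarse line, hence NON-axial) is pivotal for `Aloc m F η` in a
configuration `(ω ∖ Rm) ∪ S`, `Rm ∪ S` consisting of genuine lattice edges within two steps of `v`.

Proof.  Pivotality gives a quad `F i₀` crossed inside the drawing of `ρ = (ω ∪ {e}) ∩ window` and
not inside that of `ρ ∖ {e}`; it contains the cell (else the crossing would not see `e`), so
`freeCell_surgery` applies to it: `Rm` = cell edges and lattice edges at two corners, `S ∋ e'` an
arc of the cell boundary, `F i₀` crossed by `(ρ ∖ Rm) ∪ S ⊆ ω' ∩ window` and not by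
`(ρ ∖ Rm) ∪ (S ∖ {e'}) ⊇ (ω' ∖ {e'}) ∩ window`.  Every other quad misses the cell, and its
crossing inside the drawing of `ρ` is trimmed off every lattice edge at a corner
(`crossing_sdiff_cornerEdges`: the drawn corners lie off its carrier, spurs along such edges are
cut by `trimmed_link`, twice), so it stays crossed in `ω'`.  (Lattice bookkeeping: a lattice
step moves each coordinate by at most one, `PlaneNonIntersection.abs_sub_le_one_of_adj`.)  No
percolation, no named fact.
-/

noncomputable section

namespace Summit.CriticalPhenomena.CardyFormulaZ2.Theorems.CardySelfRefinement

open scoped Topology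
open Filter Set MeasureTheory Metric
open Literature.Probability.LatticeModels Literature.Probability.Percolation
open Literature.Probability.Percolation.QuadCrossing
open Summit.CriticalPhenomena.CardyFormulaZ2.Theses.CardySelfRefinement

variable {D : Set ℂ} {δ : ℝ}

/-! ## Quads missing the cell stay crossed -/

/-- **A quad missing the cell keeps its crossing off the corner edges.**  If the four cell edges
of the corner set `C = {p, q, p', q'}` (`p ∼ q`, `p' ∼ q'`) are drawn off `[Q]` and every
lattice edge at a corner is drawn off `∂₀Q ∪ ∂₂Q`, then a crossing of `Q` inside the drawing of
`ρ` yields one inside the drawing of `ρ` minus every lattice edge at a corner: the crossing path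
misses the drawn corners, and its spurs along such edges are trimmed (`trimmed_link` at `p`, then
at `q`). -/
theorem crossing_sdiff_cornerEdges (hδ : 0 < δ) (Q : Quad D) {p q p' q' : Site 2} {C : Set (Site 2)}
    (hC : ∀ x, x ∈ C ↔ x = p ∨ x = q ∨ x = p' ∨ x = q') (hpq : (zdGraph 2).Adj p q)
    (hp'q' : (zdGraph 2).Adj p' q') {ρ : BondConfig (Site 2)}
    (hout : ∀ x ∈ C, ∀ y ∈ C, (zdGraph 2).Adj x y →
      Disjoint (segment ℝ (meshPoint δ x) (meshPoint δ y)) Q.carrier)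
    (h02 : ∀ x ∈ C, ∀ y, (zdGraph 2).Adj x y →
      Disjoint (segment ℝ (meshPoint δ x) (meshPoint δ y)) (Q.side 0 ∪ Q.side 2))
    (hcr : ∃ K, Q.IsCrossing K ∧ K ⊆ openEdgeUnion δ ρ) :
    ∃ K, Q.IsCrossing K ∧ K ⊆ openEdgeUnion δ (ρ \ {ε | ∃ x y, ε = s(x, y) ∧ x ∈ C ∧ (zdGraph 2).Adj x y}) := by
  have hpC : p ∈ C := (hC p).2 (Or.inl rfl)
  have hqC : q ∈ C := (hC q).2 (Or.inr (Or.inl rfl))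
  have hp'C : p' ∈ C := (hC p').2 (Or.inr (Or.inr (Or.inl rfl)))
  have hq'C : q' ∈ C := (hC q').2 (Or.inr (Or.inr (Or.inr rfl)))
  -- the drawn corners and the drawn cell edges lie off `[Q]`
  have hCQ : ∀ x ∈ C, meshPoint δ x ∉ Q.carrier := fun x hx => by
    rcases (hC x).1 hx with rfl | rfl | rfl | rfl
    · exact Set.disjoint_left.1 (hout _ hpC q hqC hpq) (left_mem_segment ℝ _ _)
    · exact Set.disjoint_left.1 (hout p hpC _ hqC hpq) (right_mem_segment ℝ _ _)
    · exact Set.disjoint_left.1 (hout _ hp'C q' hq'C hp'q') (left_mem_segment ℝ _ _)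
    · exact Set.disjoint_left.1 (hout p' hp'C _ hq'C hp'q') (right_mem_segment ℝ _ _)
  have hstep : ∀ (τ : BondConfig (Site 2)) (c : Site 2), c ∈ C → ∀ {a b : ℂ}, a ∈ Q.side 0 → b ∈ Q.side 2 →
      JoinedIn (Q.carrier ∩ openEdgeUnion δ τ) a b →
      JoinedIn (Q.carrier ∩ openEdgeUnion δ
        (τ \ {ε | ∃ x y, ε = s(x, y) ∧ x ∈ C ∧ (zdGraph 2).Adj x y ∧ (y ∈ C ∨ x ≠ c)})) a b := by
    intro τ c hc a b ha hb hJ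
    set π := hJ.somePath with hπ
    have hmem : ∀ u : ℝ, π.extend u ∈ Q.carrier ∧ π.extend u ∈ openEdgeUnion δ τ := fun u => by
      have h1 : π.extend u ∈ Set.range π := by rw [← π.extend_range]; exact ⟨u, rfl⟩
      obtain ⟨s, hs⟩ := h1
      have h2 := hJ.somePath_mem s
      rw [← hπ, hs] at h2
      exact h2
    have hO : ∀ u ∈ Icc (0 : ℝ) 1, π.extend u ∈ openEdgeUnion δ
        (τ \ {ε | ∃ x y, ε = s(x, y) ∧ x ∈ C ∧ y ∈ C ∧ (zdGraph 2).Adj x y}) := fun u _ => by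
      obtain ⟨x', y', hxy', hε, hzs⟩ := mem_openEdgeUnion_iff.1 (hmem u).2
      refine mem_openEdgeUnion_iff.2 ⟨x', y', hxy', ⟨hε, ?_⟩, hzs⟩
      rintro ⟨x, y, heq, hx, hy, hxy⟩
      rw [segment_meshPoint_eq_of_sym2_eq δ heq] at hzs
      exact Set.disjoint_left.1 (hout x hx y hy hxy) hzs (hmem u).1
    have h := trimmed_link hδ Q hC hc π.continuous_extend (lo := 0) (hi := 1) (fun u _ => (hmem u).1) hO
      (fun u _ x hx hux => absurd (hmem u).1 (by rw [hux]; exact hCQ x hx))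
      (Or.inl (Or.inl ha)) ⟨0, left_mem_Icc.2 zero_le_one, π.extend_zero⟩
      (Or.inl (Or.inr hb)) ⟨1, right_mem_Icc.2 zero_le_one, π.extend_one⟩ h02
    exact h
  rw [exists_isCrossing_iff_joinedIn hδ] at hcr ⊢
  obtain ⟨a, ha, b, hb, hJ⟩ := hcr
  have hJ2 := hstep _ q hqC ha hb (hstep ρ p hpC ha hb hJ)
  refine ⟨a, ha, b, hb, joinedIn_mono_config δ Q (fun ε hε => ?_) hJ2⟩
  refine ⟨hε.1.1, ?_⟩
  rintro ⟨x, y, heq, hx, hxy⟩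
  by_cases hxp : x = p
  · refine hε.2 ⟨x, y, heq, hx, hxy, Or.inr ?_⟩
    rw [hxp]; exact hpq.ne
  · exact hε.1.2 ⟨x, y, heq, hx, hxy, Or.inr hxp⟩

/-! ## Lattice bookkeeping around the cell -/

/-- The corners of the cell beside `edgeOf (v, d)` on side `t = ±1` are within one step of `v`
in each coordinate. -/
theorem abs_freeCellCorner_sub_le (v : Site 2) (d : Fin 2) {t : ℤ} (ht : t = 1 ∨ t = -1) {x : Site 2}
    (hx : x = v ∨ x = v + dirVec d ∨ x = v + t • dirVec (1 - d) ∨ x = v + dirVec d + t • dirVec (1 - d))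
    (i : Fin 2) : |x i - v i| ≤ 1 := by
  rcases hx with rfl | rfl | rfl | rfl <;> rcases ht with rfl | rfl <;> fin_cases d <;> fin_cases i <;>
    simp [dirVec, Matrix.vecHead, Matrix.vecTail]

/-- **The rail is not axial.**  For an axial `edgeOf (v, d)` (`k ≥ 2`) the parallel edge one row
off, `edgeOf (v + t • dirVec (1 - d), d)` (`t = ±1`), is not axial. -/
theorem not_ax_rail {k : ℕ} (hk : 2 ≤ k) {v : Site 2} {d : Fin 2} (hax : ax k (v, d)) {t : ℤ}
    (ht : t = 1 ∨ t = -1) : ¬ ax k (v + t • dirVec (1 - d), d) := by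
  intro h
  have h1 : (k : ℤ) ∣ t := by
    have hsub := dvd_sub h hax
    fin_cases d <;> simpa [dirVec, Matrix.vecHead, Matrix.vecTail] using hsub
  have h2 : (k : ℤ) ∣ 1 := by rcases ht with rfl | rfl <;> simpa using h1
  have h3 : k = 1 := Nat.dvd_one.1 (by exact_mod_cast h2)
  omega

/-! ## The transfer at a free cell -/

/-- **Transfer of pivotality at a free cell** (registered helper; brick (S2) of the stub
`stub_layerLocalModification`).  See the module docstring. -/
theorem layer_transfer_of_freeCell : ∀ (k : ℕ), 2 ≤ k → ∀ (m : ℕ) (F : Fin m → Quad (Set.univ : Set ℂ)) (η : ℝ), 0 < η → ∀ (v : Site 2) (d : Fin 2) (t : ℤ), ax k (v, d) → (t = 1 ∨ t = -1) → (∀ (i : Fin m) (a b : Site 2), a ∈ ({v, v + dirVec d, v + t • dirVec (1 - d), v + dirVec d + t • dirVec (1 - d)} : Set (Site 2)) → (zdGraph 2).Adj a b → Disjoint (segment ℝ (meshPoint (η * Real.sqrt 2) a) (meshPoint (η * Real.sqrt 2) b)) ((F i).side 0 ∪ (F i).side 2)) → (∀ i : Fin m, (∀ a ∈ ({v, v +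 dirVec d, v + t • dirVec (1 - d), v + dirVec d + t • dirVec (1 - d)} : Set (Site 2)), ∀ b ∈ ({v, v + dirVec d, v + t • dirVec (1 - d), v + dirVec d + t • dirVec (1 - d)} : Set (Site 2)), (zdGraph 2).Adj a b → segment ℝ (meshPoint (η * Real.sqrt 2) a) (meshPoint (η * Real.sqrt 2) b) ⊆ (F i).carrier) ∨ (∀ a ∈ ({v, v + dirVec d, v + t • dirVec (1 - d), v + dirVec d + t • dirVec (1 - d)} : Set (Site 2)), ∀ b ∈ ({v, v + dirVec d, v + t • dirVec (1 - d), v + dirVec d + t • dirVec (1 - d)} : Set (Site 2)), (zdGraph 2).Adj a b → Disjoint (segment ℝ (meshPoint (η * Real.sqrt 2) a) (meshPoint (η * Real.sqrt 2) b)) (F i).carrier)) → (∀ i j : Fin m, (∀ a ∈ ({v, v + dirVec d, v + t • dirVec (1 - d), v + dirVec d + t • dirVec (1 - d)} : Set (Site 2)), ∀ b ∈ ({v, v + dirVec d, v + t • dirVec (1 - d), v + dirVec d + t • dirVec (1 - d)} : Set (Site 2)), (zdGraph 2).Adj a b → segment ℝ (meshPoint (η * Real.sqrt 2) a) (meshPoint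 (η * Real.sqrt 2) b) ⊆ (F i).carrier) → (∀ a ∈ ({v, v + dirVec d, v + t • dirVec (1 - d), v + dirVec d + t • dirVec (1 - d)} : Set (Site 2)), ∀ b ∈ ({v, v + dirVec d, v + t • dirVec (1 - d), v + dirVec d + t • dirVec (1 - d)} : Set (Site 2)), (zdGraph 2).Adj a b → segment ℝ (meshPoint (η * Real.sqrt 2) a) (meshPoint (η * Real.sqrt 2) b) ⊆ (F j).carrier) → i = j) → ∀ ω : BondConfig (Site 2), IsPivotal (Aloc m F η) (edgeOf (v, d)) ω → ∃ (Rm S : Set (Sym2 (Site 2))) (e' : Sym2 (Site 2)), (∃ (v' : Site 2) (d' : Fin 2), e' = edgeOf (v', d') ∧ ¬ ax k (v', d') ∧ ∀ i, |v' i - v i| ≤ (2 : ℤ)) ∧ (∀ x ∈ Rm ∪ S, ∃ a b : Site 2, x = s(a, b) ∧ (zdGraph 2).Adj a b ∧ ∀ i, |a i - v i| ≤ (2 : ℤ) ∧ |b i - v i| ≤ (2 : ℤ)) ∧ IsPivotal (Aloc m F η) e' ((ω \ Rm) ∪ S) := by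
  intro k hk m F η hη v d t hax ht h02 hdich huniq ω hpiv
  classical
  set dd : ℝ := η * Real.sqrt 2 with hdd_def
  have hdd : 0 < dd := by positivity
  -- the frame and the four corners
  obtain ⟨V, hV⟩ : ∃ V : ℤ → ℤ → Site 2, ∀ a b, V a b = v + a • dirVec d + b • dirVec (1 - d) :=
    ⟨_, fun _ _ => rfl⟩
  set q : Site 2 := v + dirVec d with hq
  set p' : Site 2 := v + t • dirVec (1 - d) with hp'
  set q' : Site 2 := v + dirVec d + t • dirVec (1 - d) with hq'
  have e00 : V 0 0 = v := by rw [hV]; simp only [zero_smul, add_zero]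
  have e10 : V 1 0 = q := by rw [hV, hq]; simp only [one_smul, zero_smul, add_zero]
  have e0t : V 0 t = p' := by rw [hV, hp']; simp only [zero_smul, add_zero]
  have e1t : V 1 t = q' := by rw [hV, hq']; simp only [one_smul]
  have hfr := frame_std d
  have hpq : (zdGraph 2).Adj v q := by
    have := frame_adj hV hfr (a := 0) (b := 0) (a' := 1) (b' := 0) (Or.inl ⟨by norm_num, rfl⟩)
    rwa [e00, e10] at this
  have hpp' : (zdGraph 2).Adj v p' := by
    have := frame_adj hV hfr (a := 0) (b := 0) (a' := 0) (b' := t) (by rcases ht with rfl | rfl <;> norm_num)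
    rwa [e00, e0t] at this
  have hp'q' : (zdGraph 2).Adj p' q' := by
    have := frame_adj hV hfr (a := 0) (b := t) (a' := 1) (b' := t) (Or.inl ⟨by norm_num, rfl⟩)
    rwa [e0t, e1t] at this
  have hq'q : (zdGraph 2).Adj q' q := by
    have := frame_adj hV hfr (a := 1) (b := t) (a' := 1) (b' := 0) (by rcases ht with rfl | rfl <;> norm_num)
    rwa [e1t, e10] at this
  have ht0 : t ≠ 0 := by rcases ht with rfl | rfl <;> norm_num
  have hpq' : v ≠ q' := by
    have := frame_ne hV hfr (a := 0) (b := 0) (a' := 1) (b' := t) (Or.inl (by norm_num))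
    rwa [e00, e1t] at this
  have hp'q : p' ≠ q := by
    have := frame_ne hV hfr (a := 0) (b := t) (a' := 1) (b' := 0) (Or.inl (by norm_num))
    rwa [e0t, e10] at this
  set C : Set (Site 2) := {v, q, p', q'} with hCdef
  have hC : ∀ x, x ∈ C ↔ x = v ∨ x = q ∨ x = p' ∨ x = q' := fun x => by
    simp only [hCdef, Set.mem_insert_iff, Set.mem_singleton_iff]
  have hpC : v ∈ C := (hC v).2 (Or.inl rfl)
  have hqC : q ∈ C := (hC q).2 (Or.inr (Or.inl rfl))
  have hnear : ∀ x ∈ C, ∀ y, (zdGraph 2).Adj x y → ∀ i, |x i - v i| ≤ 2 ∧ |y i - v i| ≤ 2 := by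
    intro x hx y hxy i
    have h1 := abs_freeCellCorner_sub_le v d ht ((hC x).1 hx) i
    have h2 := Literature.Probability.RandomPlanarGeometry.PlaneNonIntersection.abs_sub_le_one_of_adj hxy i
    have h3 := abs_sub_le (y i) (x i) (v i)
    exact ⟨h1.trans (by norm_num), by linarith⟩
  -- pivotality, in and out
  set e : Sym2 (Site 2) := edgeOf (v, d) with he_def
  have he_eq : e = s(v, q) := rfl
  set W : Set (Sym2 (Site 2)) := window m F η with hW_def
  have hW : W ⊆ (zdGraph 2).edgeSet := Set.iUnion_subset fun i => Set.inter_subset_right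
  have h1 : insert e ω ∈ Aloc m F η ∧ ω \ {e} ∉ Aloc m F η := by
    rcases hpiv with ⟨ha, hb⟩ | ⟨ha, hb⟩
    · exact ⟨ha, hb⟩
    · exact absurd (isUpperSet_Aloc m F η (Set.sdiff_subset.trans (Set.subset_insert e ω)) ha) hb
  obtain ⟨hin, hout⟩ := h1
  have hin' : ∀ i, F i ∈ configOf squareLatticeEmbedding.z η Set.univ (insert e ω ∩ W) := hin
  have hout' : ¬ ∀ i, F i ∈ configOf squareLatticeEmbedding.z η Set.univ (ω \ {e} ∩ W) := hout
  obtain ⟨i₀, hi₀⟩ := not_forall.1 hout'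
  set ρ : BondConfig (Site 2) := insert e ω ∩ W with hρ_def
  set σ : BondConfig (Site 2) := ω \ {e} ∩ W with hσ_def
  have hρE : ρ ⊆ (zdGraph 2).edgeSet := Set.inter_subset_right.trans hW
  have hσE : σ ⊆ (zdGraph 2).edgeSet := Set.inter_subset_right.trans hW
  rw [mem_configOf_iff_exists_isCrossing_openEdgeUnion hη hσE] at hi₀
  have hinK : ∀ i, ∃ K, (F i).IsCrossing K ∧ K ⊆ openEdgeUnion dd ρ := fun i =>
    (mem_configOf_iff_exists_isCrossing_openEdgeUnion hη hρE (F i)).1 (hin' i)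
  have hρσ : ρ \ {s(v, q)} ⊆ σ := by
    rintro x ⟨⟨hx, hxW⟩, hxe⟩
    rw [← he_eq] at hxe
    rcases Set.mem_insert_iff.1 hx with rfl | hxω
    · exact absurd rfl hxe
    · exact ⟨⟨hxω, hxe⟩, hxW⟩
  have hσ' : ¬ ∃ K, (F i₀).IsCrossing K ∧ K ⊆ openEdgeUnion dd (ρ \ {s(v, q)}) :=
    fun ⟨K, hK, hKσ⟩ => hi₀ ⟨K, hK, hKσ.trans (openEdgeUnion_mono dd hρσ)⟩
  -- the failing quad contains the cell
  have hIN : ∀ a ∈ C, ∀ b ∈ C, (zdGraph 2).Adj a b →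
      segment ℝ (meshPoint dd a) (meshPoint dd b) ⊆ (F i₀).carrier := by
    rcases hdich i₀ with h | h
    · exact h
    · exfalso
      refine hσ' (crossing_of_subset_union_of_disjoint dd (F i₀) (R := {s(v, q)})
        (fun x hx => by by_cases h' : x = s(v, q); exacts [Or.inr h', Or.inl ⟨hx, h'⟩])
        (fun z hz => Set.disjoint_left.1 (h v hpC q hqC hpq) (openEdgeUnion_singleton_subset dd _ _ hz))
        (hinK i₀))
  have h02₀ : ∀ x ∈ C, ∀ y, (zdGraph 2).Adj x y →
      Disjoint (segment ℝ (meshPoint dd x) (meshPoint dd y)) ((F i₀).side 0 ∪ (F i₀).side 2) :=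
    fun x hx y hxy => h02 i₀ x y hx hxy
  -- the surgery on the failing quad
  obtain ⟨Rm, S, hRS, hcellRm, hScell, hrS, hcross, hnocross⟩ :=
    freeCell_surgery hdd (F i₀) v q p' q' C ρ hC hpq hpp' hp'q' hq'q hpq' hp'q (hinK i₀) hσ' hIN h02₀
  have heRm : e ∈ Rm := hcellRm v hpC q hqC hpq
  have hS_W : S ⊆ W := fun x hx => by
    obtain ⟨a, b, rfl, ha, hb, hab⟩ := hScell x hx
    refine Set.mem_iUnion.2 ⟨i₀, ⟨a, b, rfl, ⟨meshPoint dd a, ?_, ?_⟩⟩, (SimpleGraph.mem_edgeSet _).2 hab⟩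
    · rw [eta_mul_z_eq_meshPoint, eta_mul_z_eq_meshPoint]
      exact left_mem_segment ℝ _ _
    · exact Metric.self_subset_thickening (by norm_num) _ (hIN a ha b hb hab (left_mem_segment ℝ _ _))
  -- the modified configuration
  set ω' : BondConfig (Site 2) := ω \ Rm ∪ S with hω'_def
  set e' : Sym2 (Site 2) := s(p', q') with he'_def
  have he'ω' : e' ∈ ω' := Or.inr hrS
  have hins : insert e' ω' = ω' := Set.insert_eq_of_mem he'ω'
  have hω'W : ω' ∩ W ⊆ (zdGraph 2).edgeSet := Set.inter_subset_right.trans hW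
  have hsub1 : ρ \ Rm ∪ S ⊆ ω' ∩ W := by
    rintro x (⟨⟨hx, hxW⟩, hxR⟩ | hx)
    · rcases Set.mem_insert_iff.1 hx with rfl | hxω
      · exact absurd heRm hxR
      · exact ⟨Or.inl ⟨hxω, hxR⟩, hxW⟩
    · exact ⟨Or.inr hx, hS_W hx⟩
  -- (a) every quad stays crossed
  have hall : ∀ i, F i ∈ configOf squareLatticeEmbedding.z η Set.univ (ω' ∩ W) := by
    intro i
    rw [mem_configOf_iff_exists_isCrossing_openEdgeUnion hη hω'W]
    by_cases hIi : ∀ a ∈ C, ∀ b ∈ C, (zdGraph 2).Adj a b →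
        segment ℝ (meshPoint dd a) (meshPoint dd b) ⊆ (F i).carrier
    · obtain rfl : i = i₀ := huniq i i₀ hIi hIN
      obtain ⟨K, hK, hKsub⟩ := hcross
      exact ⟨K, hK, hKsub.trans (openEdgeUnion_mono dd hsub1)⟩
    · have hOi := (hdich i).resolve_left hIi
      obtain ⟨K, hK, hKsub⟩ := crossing_sdiff_cornerEdges hdd (F i) hC hpq hp'q' hOi
        (fun x hx y hxy => h02 i x y hx hxy) (hinK i)
      refine ⟨K, hK, hKsub.trans (openEdgeUnion_mono dd ?_)⟩
      rintro x ⟨⟨hx, hxW⟩, hxC⟩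
      have hxR : x ∉ Rm := fun h => hxC (hRS x (Or.inl h))
      rcases Set.mem_insert_iff.1 hx with rfl | hxω
      · exact absurd heRm hxR
      · exact ⟨Or.inl ⟨hxω, hxR⟩, hxW⟩
  -- (b) closing the rail fails the failing quad
  have hfail : F i₀ ∉ configOf squareLatticeEmbedding.z η Set.univ ((ω' \ {e'}) ∩ W) := by
    have hE : (ω' \ {e'}) ∩ W ⊆ (zdGraph 2).edgeSet := Set.inter_subset_right.trans hW
    rw [mem_configOf_iff_exists_isCrossing_openEdgeUnion hη hE]
    rintro ⟨K, hK, hKsub⟩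
    refine hnocross ⟨K, hK, hKsub.trans (openEdgeUnion_mono dd ?_)⟩
    rintro x ⟨⟨hx | hx, hxe'⟩, hxW⟩
    · exact Or.inl ⟨⟨Set.mem_insert_of_mem _ hx.1, hxW⟩, hx.2⟩
    · exact Or.inr ⟨hx, hxe'⟩
  refine ⟨Rm, S, e', ⟨p', d, ?_, not_ax_rail hk hax ht, fun i => ?_⟩, fun x hx => ?_,
    Or.inl ⟨?_, fun h => hfail (h i₀)⟩⟩
  · have hq'' : q' = p' + dirVec d := by rw [hq', hp', add_right_comm]
    rw [he'_def, hq'']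
  · exact (abs_freeCellCorner_sub_le v d ht (Or.inr (Or.inr (Or.inl rfl))) i).trans (by norm_num)
  · obtain ⟨a, b, rfl, ha, hab⟩ := hRS x hx
    exact ⟨a, b, rfl, hab, hnear a ha b hab⟩
  · rw [hins]
    exact hall

end Summit.CriticalPhenomena.CardyFormulaZ2.Theorems.CardySelfRefinement

end
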